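import Summits.Ventures.HSemireg.WedgeHankelRecurrenceModuli
import Summits.Ventures.HSemireg.WedgeHankelRecurrenceSynthesis

/-!
# Venture HSemireg — THE CLASSES KILLED BY A RECURRENCE ARE THE DUAL OF `K[X]/(m)`: for a monic `m` of degree `d`, **every class `q` on `[0, N]` with `m ∈ Rec_d(q)` is, uniquely,
# the DUAL CLASS `q_j = [X^{d−1}] (X^j · a mod m)` of a residue `a` with `deg a < d`** (N26's characteristic sequence is `a = 1`; the shift acts as multiplication by `X`); its recurrences
# inside the window are `{p : m ∣ p · a}`, so **its minimal recurrence is `m / gcd(m, a)` — it is `m` itself, with `R(q) = d`, exactly when `a` is a UNIT modulo `m`**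

HONEST FRAMING. Part of the Lean index of the computation cell `pub-hsemireg` (seat p10 gen 27, Sunday typer «UNIFORM-IN-n»).
LINEAR ALGEBRA OF HANKEL (catalecticant) MATRICES and of polynomials over a field ONLY (`Polynomial.modByMonic`): no variety, no cohomology theory, no sheaf, no Ext group and no
semiregularity map is constructed here; nothing here says that HC / HC_CM / HC_AV holds; no Literature fact is declared or used.  Custodian versions as in `WedgeHankelSiegelIdeal` (1/3); the
dictionary (`dualSeq m a` = the moments of the functional `x ↦ [X^{d−1}](a·x mod m)` on `K[X]/(m)`; «the dual of `K[X]/(m)` is free of rank one over `K[X]/(m)`» = the one-variable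
Frobenius / Gorenstein / Macaulay duality; `R(q) = rank H_{⌊N/2⌋}(q)`) is QUOTED, never asserted.

WHAT IS IN THE TREE.  N26 (`WedgeHankelRecurrenceModuli`, № 179): `charSeq`, `hkFun_charSeq`, `eq_zero_of_forall_coeff_X_pow_mul_modByMonic` (non-degeneracy of the pairing on residues),
`mem_recSpace_charSeq_iff`, `recSpace_charSeq_self_eq_span`, `rank_hankel1_half_charSeq`; N23 (`WedgeHankelRecurrenceSynthesis`, № 176): `recSpace_congr`, `eq_of_monic_recurrence` (unique
continuation), `hkFun_eq_zero_of_mem_recSpace`; N18 (№ 173): `recSpace`, `mem_recSpace_iff`, `hkFun_monomial`, `recSpace_eq_bot_of_lt`, `finrank_recSpace_self`, `finiteDimensional_recSpace`,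
`natDegree_le_of_mem_recSpace`, `recSpace_le_degreeLT`, `mem_degreeLT_succ_iff`.  Mathlib: `Polynomial.modByMonic_eq_of_dvd_sub`, `add_modByMonic`, `smul_modByMonic`, `modByMonic_eq_sub_mul_div`,
`modByMonic_eq_zero_iff_dvd`, `div_modByMonic_unique`, `natDegree_modByMonic_lt`, `LinearMap.injective_iff_surjective_of_finrank_eq_finrank`, `IsCoprime`.
THIS FILE (namespace `Summit.Ventures.HSemireg.Wedge.HankelOuter` continued; PLAIN over the tree; 1 definition `dualSeq`):
* §509 `dualSeq m a j := [X^{d−1}] (X^j · a mod m)`; `dualSeq_one` (`= charSeq m`), `dualSeq_eq_hkFun_charSeq` (`= ⟪a, charSeq m⟫_j`), **`hkFun_dualSeq`** (`⟪p, dualSeq m a⟫_s = [X^{d−1}]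
  (X^s · p · a mod m)`), `dualSeq_add`, `dualSeq_smul`, `dualSeq_congr_mod` (`m ∣ a − b ⇒` equal), `dualSeq_modByMonic`, **`dualSeq_X_mul`** (`dualSeq m (X·a) = σ (dualSeq m a)`: THE SHIFT IS
  MULTIPLICATION BY `X`), `dualSeq_X_pow_mul`, `dualSeq_eq_zero_of_dvd` (`m ∣ a ⇒ dualSeq m a = 0`).
* §510 **`mem_recSpace_dualSeq_of_dvd`** (`deg p ≤ k`, `m ∣ p · a ⇒ p ∈ Rec_k(dualSeq m a)`, every `N`), `mem_recSpace_dualSeq` (`m ∈ Rec_d(dualSeq m a)`), **`mem_recSpace_dualSeq_iff`** (`k + d ≤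
  N + 1`: `p ∈ Rec_k(dualSeq m a) ↔ deg p ≤ k ∧ m ∣ p · a` — N26's non-degeneracy applied to `p · a mod m`).
* §511 THE DUALITY: `eq_zero_of_dualSeq_eq_zero` (`deg a < d`: `dualSeq m a = 0` on `[0, d)` only for `a = 0`), **`exists_dualSeq_eq_on_lt`** (every vector of `d` initial values is taken),
  **`exists_dualSeq_of_mem_recSpace`** (`m ∈ Rec_d(q) ⇒ ∃ a, deg a < d ∧ q = dualSeq m a on [0, N]`), `mem_recSpace_of_eq_dualSeq` (converse), **`exists_dualSeq_iff_mem_recSpace`**,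
  **`dualSeq_unique`** (`d ≤ N + 1`, `deg a, deg b < d`, equal on `[0, N] ⇒ a = b`) — the classes on `[0, N]` killed by `m` ARE `K[X]/(m)`, `N ≥ d − 1`.
* §512 units and non-units modulo `m`: `dualSeq_mul_left` (`(g·m₁, g·a₁) ↦ lc(g) • dualSeq m₁ a₁`: a common factor passes to a SHORTER recurrence), **`recSpace_dualSeq_eq_of_isCoprime`**
  (`IsCoprime m a`, `k + d ≤ N + 1 ⇒ Rec_k(dualSeq m a) = Rec_k(charSeq m)`), **`rank_hankel1_half_dualSeq_of_isCoprime`** (`2d ≤ N + 1 ⇒ R = d`), `recSpace_dualSeq_self_eq_span_of_isCoprime`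
  (`Rec_d = K · m`), **`mem_recSpace_dualSeq_of_mul_dvd`** (`m = g · m₁`, `g ∣ a ⇒ m₁ ∈ Rec_{deg m₁}(dualSeq m a)`), **`rank_hankel1_half_dualSeq_lt_of_not_isCoprime`** (not coprime ⇒
  `R(dualSeq m a) < d`), **`rank_hankel1_half_dualSeq_eq_iff_isCoprime`** (`2d ≤ N + 1`: `R(dualSeq m a) = d ↔ IsCoprime m a`).
READING: N26 built ONE class with minimal recurrence `m` (the characteristic sequence); this file describes ALL classes killed by `m` — they form a copy of `K[X]/(m)` (residue `a` ↦ the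
functional `x ↦ [X^{d−1}](a x mod m)`), the shift acting as `X`, and the class is "primitive" (minimal recurrence exactly `m`, middle rank `d`) iff `a` is a unit of `K[X]/(m)`; otherwise
the common factor `gcd(m, a)` cancels and the class belongs to the smaller module `K[X]/(m / gcd)`.  With N19/N20: for split `m` these are the secant / divisor classes on the roots of `m`
and `a` records the weights.  Nothing Ext-side.  New names only.
-/

open Module Polynomial
open scoped Matrix Polynomial

namespace Summit.Ventures.HSemireg.Wedge.HankelOuter

open Summit.Ventures.HSemireg.Wedge Summit.Ventures.HSemireg.Wedge.Hankel

variable (K : Type*) [Field K] {N : ℕ}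

/-! ## §509. The dual class of a residue modulo `m` -/

/-- THE DUAL CLASS of the residue `a` modulo the monic `m` (degree `d`): `dualSeq m a j := [X^{d−1}] (X^j · a mod m)` — the moments of the functional `x ↦ [X^{d−1}](a · x mod m)` on
`K[X]/(m)` (quoted: the Macaulay / Frobenius dual; `a = 1` gives N26's characteristic sequence `charSeq m`). -/
noncomputable def dualSeq (m a : K[X]) : ℕ → K := fun j => (Polynomial.X ^ j * a %ₘ m).coeff (m.natDegree - 1)

/-- values. -/
theorem dualSeq_apply (m a : K[X]) (j : ℕ) : dualSeq K m a j = (Polynomial.X ^ j * a %ₘ m).coeff (m.natDegree - 1) := rfl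

/-- `dualSeq m 1 = charSeq m`. -/
@[simp] theorem dualSeq_one (m : K[X]) : dualSeq K m 1 = charSeq K m := by
  funext j; rw [dualSeq_apply, mul_one]; rfl

/-- `dualSeq m a j = ⟪a, charSeq m⟫_j`: the dual class of `a` is the row of Hankel functionals of `a` against the characteristic sequence. -/
theorem dualSeq_eq_hkFun_charSeq (m a : K[X]) (j : ℕ) : dualSeq K m a j = hkFun K (charSeq K m) j a := (hkFun_charSeq K m j a).symm

/-- **`⟪p, dualSeq m a⟫_s = [X^{d−1}] (X^s · p · a mod m) = ⟪p · a, charSeq m⟫_s`.** -/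
theorem hkFun_dualSeq (m a : K[X]) (s : ℕ) (p : K[X]) : hkFun K (dualSeq K m a) s p = (Polynomial.X ^ s * (p * a) %ₘ m).coeff (m.natDegree - 1) := by
  induction p using Polynomial.induction_on' with
  | add p p' hp hp' => rw [map_add, hp, hp', add_mul, mul_add, Polynomial.add_modByMonic, Polynomial.coeff_add]
  | monomial i c =>
    rw [hkFun_monomial, dualSeq_apply, ← Polynomial.C_mul_X_pow_eq_monomial, show Polynomial.X ^ s * (Polynomial.C c * Polynomial.X ^ i * a)
      = c • (Polynomial.X ^ (i + s) * a) by rw [Polynomial.C_mul', smul_mul_assoc, mul_smul_comm, ← mul_assoc, ← pow_add, add_comm],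
      Polynomial.smul_modByMonic, Polynomial.coeff_smul, smul_eq_mul]

/-- `⟪p, dualSeq m a⟫_s = ⟪p · a, charSeq m⟫_s`. -/
theorem hkFun_dualSeq_eq_hkFun_charSeq (m a : K[X]) (s : ℕ) (p : K[X]) : hkFun K (dualSeq K m a) s p = hkFun K (charSeq K m) s (p * a) := by
  rw [hkFun_dualSeq, hkFun_charSeq]

/-- additive in the residue. -/
theorem dualSeq_add (m a b : K[X]) : dualSeq K m (a + b) = dualSeq K m a + dualSeq K m b := by
  funext j; simp only [dualSeq_apply, Pi.add_apply, mul_add, Polynomial.add_modByMonic, Polynomial.coeff_add]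

/-- homogeneous in the residue. -/
theorem dualSeq_smul (m : K[X]) (c : K) (a : K[X]) : dualSeq K m (c • a) = c • dualSeq K m a := by
  funext j; simp only [dualSeq_apply, Pi.smul_apply, mul_smul_comm, Polynomial.smul_modByMonic, Polynomial.coeff_smul]

/-- the dual class only depends on `a` modulo `m`: `m ∣ a − b ⇒ dualSeq m a = dualSeq m b`. -/
theorem dualSeq_congr_mod {m : K[X]} (hm : m.Monic) {a b : K[X]} (h : m ∣ a - b) : dualSeq K m a = dualSeq K m b := by
  funext j
  rw [dualSeq_apply, dualSeq_apply, Polynomial.modByMonic_eq_of_dvd_sub hm (by rw [← mul_sub]; exact dvd_mul_of_dvd_right h _)]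

/-- in particular `dualSeq m (a mod m) = dualSeq m a`. -/
theorem dualSeq_modByMonic {m : K[X]} (hm : m.Monic) (a : K[X]) : dualSeq K m (a %ₘ m) = dualSeq K m a :=
  dualSeq_congr_mod K hm (by rw [Polynomial.modByMonic_eq_sub_mul_div a m, sub_sub_cancel_left, dvd_neg]; exact dvd_mul_right m _)

/-- **THE SHIFT IS MULTIPLICATION BY `X`: `dualSeq m (X · a) j = dualSeq m a (j + 1)`** (the module structure of the dual of `K[X]/(m)`). -/
theorem dualSeq_X_mul (m a : K[X]) (j : ℕ) : dualSeq K m (Polynomial.X * a) j = dualSeq K m a (j + 1) := by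
  rw [dualSeq_apply, dualSeq_apply, ← mul_assoc, ← pow_succ]

/-- … and by `X^t`: `dualSeq m (X^t · a) j = dualSeq m a (j + t)`. -/
theorem dualSeq_X_pow_mul (m a : K[X]) (t j : ℕ) : dualSeq K m (Polynomial.X ^ t * a) j = dualSeq K m a (j + t) := by
  rw [dualSeq_apply, dualSeq_apply, ← mul_assoc, ← pow_add]

/-- `m ∣ a ⇒ dualSeq m a = 0`. -/
theorem dualSeq_eq_zero_of_dvd {m : K[X]} (hm : m.Monic) {a : K[X]} (h : m ∣ a) : dualSeq K m a = 0 := by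
  funext j
  rw [dualSeq_apply, (Polynomial.modByMonic_eq_zero_iff_dvd hm).mpr (dvd_mul_of_dvd_right h _), Polynomial.coeff_zero, Pi.zero_apply]

/-! ## §510. The recurrences of a dual class: `p` with `m ∣ p · a` -/

/-- **`deg p ≤ k`, `m ∣ p · a ⇒ p ∈ Rec_k(dualSeq m a)`** (every window, every `N`). -/
theorem mem_recSpace_dualSeq_of_dvd {m : K[X]} (hm : m.Monic) (a : K[X]) {k : ℕ} {p : K[X]} (hp : p ∈ Polynomial.degreeLT K (k + 1)) (hdvd : m ∣ p * a) :
    p ∈ recSpace K N (dualSeq K m a) k := by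
  rw [mem_recSpace_iff]
  refine ⟨hp, fun s _ => ?_⟩
  rw [hkFun_dualSeq, (Polynomial.modByMonic_eq_zero_iff_dvd hm).mpr (dvd_mul_of_dvd_right hdvd _), Polynomial.coeff_zero]

/-- `m ∈ Rec_d(dualSeq m a)`: every dual class modulo `m` satisfies the recurrence `m` (every `N`, every `a`). -/
theorem mem_recSpace_dualSeq {m : K[X]} (hm : m.Monic) (a : K[X]) : m ∈ recSpace K N (dualSeq K m a) m.natDegree :=
  mem_recSpace_dualSeq_of_dvd K hm a ((mem_degreeLT_succ_iff K).mpr le_rfl) (dvd_mul_right m a)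

/-- **THE RECURRENCES OF A DUAL CLASS INSIDE THE WINDOW: for `k + d ≤ N + 1`, `p ∈ Rec_k(dualSeq m a) ↔ deg p ≤ k ∧ m ∣ p · a`** (the pairing on `K[X]/(m)` is non-degenerate, N26). -/
theorem mem_recSpace_dualSeq_iff {m : K[X]} (hm : m.Monic) (a : K[X]) {k : ℕ} (hk : k + m.natDegree ≤ N + 1) (p : K[X]) :
    p ∈ recSpace K N (dualSeq K m a) k ↔ p ∈ Polynomial.degreeLT K (k + 1) ∧ m ∣ p * a := by
  refine ⟨fun hp => ⟨recSpace_le_degreeLT K _ k hp, ?_⟩, fun h => mem_recSpace_dualSeq_of_dvd K hm a h.1 h.2⟩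
  rw [← Polynomial.modByMonic_eq_zero_iff_dvd hm]
  by_cases hm1 : m = 1
  · rw [hm1, Polynomial.modByMonic_one]
  refine eq_zero_of_forall_coeff_X_pow_mul_modByMonic K hm (Polynomial.natDegree_modByMonic_lt _ hm hm1) fun s hs => ?_
  have e : Polynomial.X ^ s * (p * a %ₘ m) %ₘ m = Polynomial.X ^ s * (p * a) %ₘ m :=
    Polynomial.modByMonic_eq_of_dvd_sub hm (by
      rw [← mul_sub, Polynomial.modByMonic_eq_sub_mul_div (p * a) m, sub_sub_cancel_left, mul_neg, dvd_neg]
      exact dvd_mul_of_dvd_right (dvd_mul_right m _) _)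
  rw [e, ← hkFun_dualSeq]
  exact ((mem_recSpace_iff K).mp hp).2 s (by omega)

/-! ## §511. The duality: the classes on `[0, N]` killed by `m` are exactly the dual classes, `a ↦ dualSeq m a` is a bijection from `K[X]_{< d}` -/

/-- `deg a < d`: **`dualSeq m a` vanishes on `[0, d)` only for `a = 0`** (non-degeneracy: `[X^{d−1}](X^s a mod m) = 0` for `s < d` forces `a = 0`). -/
theorem eq_zero_of_dualSeq_eq_zero {m a : K[X]} (hm : m.Monic) (ha : a.natDegree < m.natDegree) (h : ∀ j < m.natDegree, dualSeq K m a j = 0) : a = 0 :=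
  eq_zero_of_forall_coeff_X_pow_mul_modByMonic K hm ha fun s hs => h s hs

/-- **every vector of `d` initial values is the start of a dual class: `∃ a, deg a < d ∧ dualSeq m a j = x_j` (`j < d`)** (the linear map `K[X]_{< d} → K^d` is injective between spaces
of the same dimension, hence onto). -/
theorem exists_dualSeq_eq_on_lt {m : K[X]} (hm : m.Monic) (x : Fin m.natDegree → K) :
    ∃ a : K[X], a ∈ Polynomial.degreeLT K m.natDegree ∧ ∀ j : Fin m.natDegree, dualSeq K m a j = x j := by
  let φ : Polynomial.degreeLT K m.natDegree →ₗ[K] (Fin m.natDegree → K) :=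
    { toFun := fun a j => dualSeq K m (a : K[X]) j
      map_add' := fun a b => by funext j; rw [Submodule.coe_add, dualSeq_add]; rfl
      map_smul' := fun c a => by funext j; rw [Submodule.coe_smul, dualSeq_smul]; rfl }
  have hinj : Function.Injective φ := by
    rw [injective_iff_map_eq_zero]
    intro a ha
    have hdeg : (a : K[X]).natDegree < m.natDegree ∨ (a : K[X]) = 0 := by
      rcases eq_or_ne (a : K[X]) 0 with h0 | h0
      · exact Or.inr h0
      · exact Or.inl ((Polynomial.mem_degreeLT.mp a.2).trans_le le_rfl |> fun h => (Polynomial.natDegree_lt_iff_degree_lt h0).mpr h)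
    rcases hdeg with hlt | h0
    · exact Subtype.ext (eq_zero_of_dualSeq_eq_zero K hm hlt fun j hj => congrFun ha ⟨j, hj⟩)
    · exact Subtype.ext h0
  have hsurj : Function.Surjective φ := by
    refine (LinearMap.injective_iff_surjective_of_finrank_eq_finrank ?_).mp hinj
    rw [finrank_polynomial_degreeLT, Module.finrank_fin_fun]
  obtain ⟨a, ha⟩ := hsurj x
  exact ⟨a, a.2, fun j => by have h := congrFun ha j; exact h⟩

/-- **DUALITY, EXISTENCE: if the monic `m` of degree `d` is a recurrence of `q` of window `d + 1` on `[0, N]`, then `q = dualSeq m a` on `[0, N]` for some residue `a` with `deg a < d`**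
(match the `d` initial values, then unique continuation of the monic recurrence, N23). -/
theorem exists_dualSeq_of_mem_recSpace {m : K[X]} (hm : m.Monic) {q : ℕ → K} (hq : m ∈ recSpace K N q m.natDegree) :
    ∃ a : K[X], a ∈ Polynomial.degreeLT K m.natDegree ∧ ∀ j ≤ N, q j = dualSeq K m a j := by
  obtain ⟨a, ha, hx⟩ := exists_dualSeq_eq_on_lt K hm (fun j => q j)
  refine ⟨a, ha, eq_of_monic_recurrence K hm rfl (hkFun_eq_zero_of_mem_recSpace K hq)
    (hkFun_eq_zero_of_mem_recSpace K (mem_recSpace_dualSeq K (N := N) hm a)) fun j hj => ?_⟩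
  exact (hx ⟨j, hj⟩).symm

/-- conversely a class equal on `[0, N]` to a dual class modulo `m` satisfies `m`. -/
theorem mem_recSpace_of_eq_dualSeq {m : K[X]} (hm : m.Monic) {q : ℕ → K} {a : K[X]} (h : ∀ j ≤ N, q j = dualSeq K m a j) :
    m ∈ recSpace K N q m.natDegree := by
  rw [recSpace_congr K h]
  exact mem_recSpace_dualSeq K hm a

/-- **`m ∈ Rec_d(q)` iff `q` is a dual class modulo `m` on `[0, N]`.** -/
theorem exists_dualSeq_iff_mem_recSpace {m : K[X]} (hm : m.Monic) (q : ℕ → K) :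
    (∃ a : K[X], a ∈ Polynomial.degreeLT K m.natDegree ∧ ∀ j ≤ N, q j = dualSeq K m a j) ↔ m ∈ recSpace K N q m.natDegree :=
  ⟨fun ⟨_, _, h⟩ => mem_recSpace_of_eq_dualSeq K hm h, exists_dualSeq_of_mem_recSpace K hm⟩

/-- **DUALITY, UNIQUENESS: for `d ≤ N + 1`, two residues of degree `< d` with the same dual class on `[0, N]` are equal** — so `a ↦ dualSeq m a|[0,N]` identifies `K[X]/(m)` with the
classes killed by `m`. -/
theorem dualSeq_unique {m : K[X]} (hm : m.Monic) (hdN : m.natDegree ≤ N + 1) {a b : K[X]} (ha : a ∈ Polynomial.degreeLT K m.natDegree)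
    (hb : b ∈ Polynomial.degreeLT K m.natDegree) (h : ∀ j ≤ N, dualSeq K m a j = dualSeq K m b j) : a = b := by
  rw [← sub_eq_zero]
  have hab : a - b ∈ Polynomial.degreeLT K m.natDegree := Submodule.sub_mem _ ha hb
  rcases eq_or_ne (a - b) 0 with h0 | h0
  · exact h0
  · refine eq_zero_of_dualSeq_eq_zero K hm ((Polynomial.natDegree_lt_iff_degree_lt h0).mpr (Polynomial.mem_degreeLT.mp hab)) fun j hj => ?_
    rw [sub_eq_add_neg, dualSeq_add, ← neg_one_smul K b, dualSeq_smul, Pi.add_apply, Pi.smul_apply, smul_eq_mul, h j (by omega)]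
    ring

/-! ## §512. Units and non-units modulo `m`: the minimal recurrence of `dualSeq m a` is `m / gcd(m, a)` -/

/-- **a common factor passes to a shorter recurrence: `dualSeq (g · m₁) (g · a₁) = lc(g) • dualSeq m₁ a₁`** (`m₁` monic, `g ≠ 0`; `(g x) mod (g m₁) = g · (x mod m₁)`). -/
theorem dualSeq_mul_left {g m₁ : K[X]} (hg : g ≠ 0) (hm₁ : m₁.Monic) (hgm : (g * m₁).Monic) (a₁ : K[X]) :
    dualSeq K (g * m₁) (g * a₁) = g.leadingCoeff • dualSeq K m₁ a₁ := by
  funext j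
  rw [Pi.smul_apply, smul_eq_mul, dualSeq_apply, dualSeq_apply]
  -- division with remainder by `g m₁`: `X^j g a₁ = (g m₁) · (X^j a₁ / m₁) + g · (X^j a₁ mod m₁)`
  have hdiv := (Polynomial.div_modByMonic_unique (f := Polynomial.X ^ j * (g * a₁)) (Polynomial.X ^ j * a₁ /ₘ m₁) (g * (Polynomial.X ^ j * a₁ %ₘ m₁)) hgm
    ⟨by rw [mul_assoc g m₁, ← mul_add, Polynomial.modByMonic_add_div (Polynomial.X ^ j * a₁) m₁]; ring,
     by
      rcases eq_or_ne (Polynomial.X ^ j * a₁ %ₘ m₁) 0 with h0 | h0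
      · rw [h0, mul_zero, Polynomial.degree_zero]; exact Ne.bot_lt (Polynomial.degree_eq_bot.not.mpr hgm.ne_zero)
      · rw [Polynomial.degree_mul, Polynomial.degree_mul, Polynomial.degree_eq_natDegree hg, Polynomial.degree_eq_natDegree h0,
          Polynomial.degree_eq_natDegree hm₁.ne_zero, ← Nat.cast_add, ← Nat.cast_add, Nat.cast_lt]
        have := Polynomial.natDegree_modByMonic_lt (Polynomial.X ^ j * a₁) hm₁ (fun h1 => h0 (by rw [h1, Polynomial.modByMonic_one]))
        omega⟩).2
  rw [hdiv, Polynomial.natDegree_mul hg hm₁.ne_zero]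
  -- top coefficient of `g · r` with `deg r < d₁`
  rcases Nat.eq_zero_or_pos m₁.natDegree with hd₁ | hd₁
  · have hm1 : m₁ = 1 := Polynomial.eq_one_of_monic_natDegree_zero hm₁ hd₁
    rw [hm1, Polynomial.modByMonic_one, mul_zero, Polynomial.coeff_zero, Polynomial.coeff_zero, mul_zero]
  · rw [show g.natDegree + m₁.natDegree - 1 = g.natDegree + (m₁.natDegree - 1) by omega]
    rcases eq_or_ne (Polynomial.X ^ j * a₁ %ₘ m₁) 0 with h0 | h0
    · rw [h0, mul_zero, Polynomial.coeff_zero, Polynomial.coeff_zero, mul_zero]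
    · have hlt := Polynomial.natDegree_modByMonic_lt (Polynomial.X ^ j * a₁) hm₁ (fun h1 => by rw [h1, Polynomial.natDegree_one] at hd₁; exact lt_irrefl 0 hd₁)
      rcases Nat.lt_or_ge (Polynomial.X ^ j * a₁ %ₘ m₁).natDegree (m₁.natDegree - 1) with hlt' | hge
      · rw [Polynomial.coeff_eq_zero_of_natDegree_lt (by rw [Polynomial.natDegree_mul hg h0]; omega), Polynomial.coeff_eq_zero_of_natDegree_lt hlt', mul_zero]
      · have heq : (Polynomial.X ^ j * a₁ %ₘ m₁).natDegree = m₁.natDegree - 1 := by omega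
        rw [← heq, ← Polynomial.natDegree_mul hg h0, Polynomial.coeff_natDegree, Polynomial.leadingCoeff_mul, Polynomial.coeff_natDegree]

/-- **for `a` a unit modulo `m` the recurrences are those of the characteristic sequence: `IsCoprime m a`, `k + d ≤ N + 1 ⇒ Rec_k(dualSeq m a) = Rec_k(charSeq m)`** (`m ∣ p a ↔ m ∣ p`). -/
theorem recSpace_dualSeq_eq_of_isCoprime {m a : K[X]} (hm : m.Monic) (hcop : IsCoprime m a) {k : ℕ} (hk : k + m.natDegree ≤ N + 1) :
    recSpace K N (dualSeq K m a) k = recSpace K N (charSeq K m) k := by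
  ext p
  rw [mem_recSpace_dualSeq_iff K hm a hk, mem_recSpace_charSeq_iff K hm hk]
  exact and_congr_right fun _ => ⟨fun h => hcop.dvd_of_dvd_mul_right h, fun h => dvd_mul_of_dvd_left h a⟩

/-- **`R(dualSeq m a) = d` for `a` a unit modulo `m`** (`2d ≤ N + 1`). -/
theorem rank_hankel1_half_dualSeq_of_isCoprime {m a : K[X]} (hm : m.Monic) (hcop : IsCoprime m a) (h2d : m.natDegree + m.natDegree ≤ N + 1) :
    (hankel1 K N (N / 2) (dualSeq K m a)).rank = m.natDegree := by
  -- same recurrence spaces as `charSeq m` in the degrees `d − 1` and `d`, hence the same ranks there (rank–nullity), hence the same middle rank (trapezoid law)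
  have hRle : (hankel1 K N (N / 2) (dualSeq K m a)).rank ≤ N / 2 + 1 := Matrix.rank_le_height _
  rcases Nat.eq_zero_or_pos m.natDegree with hd | hd
  · have hm1 : m = 1 := Polynomial.eq_one_of_monic_natDegree_zero hm hd
    have hz : dualSeq K m a = 0 := dualSeq_eq_zero_of_dvd K hm (by rw [hm1]; exact one_dvd a)
    have hz' : hankel1 K N (N / 2) (0 : ℕ → K) = 0 := by ext i s; rfl
    rw [hd, hz, hz', Matrix.rank_zero]
  · have hA := finrank_recSpace_add_rank K (N := N) (m.natDegree - 1) (dualSeq K m a)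
    have hA' := finrank_recSpace_add_rank K (N := N) (m.natDegree - 1) (charSeq K m)
    rw [recSpace_dualSeq_eq_of_isCoprime K hm hcop (by omega)] at hA
    have hB := finrank_recSpace_add_rank K (N := N) m.natDegree (dualSeq K m a)
    have hB' := finrank_recSpace_add_rank K (N := N) m.natDegree (charSeq K m)
    rw [recSpace_dualSeq_eq_of_isCoprime K hm hcop (by omega)] at hB
    have h1 := rank_hankel1_eq_min K (show m.natDegree - 1 ≤ N by omega) (dualSeq K m a)
    have h1' := rank_hankel1_eq_min K (show m.natDegree - 1 ≤ N by omega) (charSeq K m)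
    have h2 := rank_hankel1_eq_min K (show m.natDegree ≤ N by omega) (dualSeq K m a)
    have h2' := rank_hankel1_eq_min K (show m.natDegree ≤ N by omega) (charSeq K m)
    have hR' := rank_hankel1_half_charSeq K hm h2d
    rw [hR'] at h1' h2'
    omega

/-- … with minimal recurrence `m`: `Rec_d(dualSeq m a) = K · m`. -/
theorem recSpace_dualSeq_self_eq_span_of_isCoprime {m a : K[X]} (hm : m.Monic) (hcop : IsCoprime m a) (h2d : m.natDegree + m.natDegree ≤ N + 1) :
    recSpace K N (dualSeq K m a) m.natDegree = K ∙ m := by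
  rw [recSpace_dualSeq_eq_of_isCoprime K hm hcop h2d, recSpace_charSeq_self_eq_span K hm h2d]

/-- **a common factor of `m` and `a` shortens the recurrence: `m = g · m₁`, `g ∣ a ⇒ m₁ ∈ Rec_{deg m₁}(dualSeq m a)`** (every `N`). -/
theorem mem_recSpace_dualSeq_of_mul_dvd {m g m₁ a : K[X]} (hm : m.Monic) (hgm : m = g * m₁) (hga : g ∣ a) :
    m₁ ∈ recSpace K N (dualSeq K m a) m₁.natDegree := by
  refine mem_recSpace_dualSeq_of_dvd K hm a ((mem_degreeLT_succ_iff K).mpr le_rfl) ?_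
  obtain ⟨a₁, rfl⟩ := hga
  rw [hgm, mul_left_comm]
  exact mul_dvd_mul_left g (dvd_mul_right m₁ a₁)

/-- **a NON-unit modulo `m` gives a class of SMALLER middle rank: `¬ IsCoprime m a ⇒ R(dualSeq m a) < d`** (the quotient `m / gcd(m, a)` is a recurrence of degree `< d`; every `N`). -/
theorem rank_hankel1_half_dualSeq_lt_of_not_isCoprime [DecidableEq K] {m a : K[X]} (hm : m.Monic) (hcop : ¬ IsCoprime m a) :
    (hankel1 K N (N / 2) (dualSeq K m a)).rank < m.natDegree := by
  set g := EuclideanDomain.gcd m a with hg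
  have hg0 : g ≠ 0 := fun h => hm.ne_zero ((EuclideanDomain.gcd_eq_zero_iff.mp h).1)
  obtain ⟨m₁, hm₁⟩ : g ∣ m := EuclideanDomain.gcd_dvd_left m a
  have hga : g ∣ a := EuclideanDomain.gcd_dvd_right m a
  -- `g` is not a unit (else Bezout would make `m`, `a` coprime), so `deg m₁ < d`
  have hgu : ¬ IsUnit g := fun hu => hcop (by
    obtain ⟨u, hu⟩ := hu
    have hb := EuclideanDomain.gcd_eq_gcd_ab m a
    refine ⟨↑u⁻¹ * EuclideanDomain.gcdA m a, ↑u⁻¹ * EuclideanDomain.gcdB m a, ?_⟩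
    calc ↑u⁻¹ * EuclideanDomain.gcdA m a * m + ↑u⁻¹ * EuclideanDomain.gcdB m a * a
        = ↑u⁻¹ * (m * EuclideanDomain.gcdA m a + a * EuclideanDomain.gcdB m a) := by ring
      _ = 1 := by rw [← hb, ← hg, ← hu, Units.inv_mul])
  have hgdeg : 1 ≤ g.natDegree := by
    by_contra hlt
    exact hgu (Polynomial.isUnit_iff_degree_eq_zero.mpr (Polynomial.degree_eq_natDegree hg0 ▸ by rw [show g.natDegree = 0 by omega]; rfl))
  have hm₁0 : m₁ ≠ 0 := fun h => hm.ne_zero (by rw [hm₁, h, mul_zero])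
  have hdeg : m₁.natDegree < m.natDegree := by rw [hm₁, Polynomial.natDegree_mul hg0 hm₁0]; omega
  have hmem : m₁ ∈ recSpace K N (dualSeq K m a) m₁.natDegree := mem_recSpace_dualSeq_of_mul_dvd K hm hm₁ hga
  by_contra hge
  have hbot := recSpace_eq_bot_of_lt K (N := N) (q := dualSeq K m a) rfl (show m₁.natDegree < (hankel1 K N (N / 2) (dualSeq K m a)).rank by omega)
  rw [hbot, Submodule.mem_bot] at hmem
  exact hm₁0 hmem

/-- **THE PRIMITIVE CLASSES: for `2d ≤ N + 1`, `R(dualSeq m a) = d ↔ IsCoprime m a`** — a dual class modulo `m` has minimal recurrence exactly `m` (middle rank `d`) iff its residue is a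
unit of `K[X]/(m)`; otherwise the common factor `gcd(m, a)` cancels. -/
theorem rank_hankel1_half_dualSeq_eq_iff_isCoprime [DecidableEq K] {m a : K[X]} (hm : m.Monic) (h2d : m.natDegree + m.natDegree ≤ N + 1) :
    (hankel1 K N (N / 2) (dualSeq K m a)).rank = m.natDegree ↔ IsCoprime m a := by
  constructor
  · intro h
    by_contra hcop
    exact (rank_hankel1_half_dualSeq_lt_of_not_isCoprime K (N := N) hm hcop).ne h
  · intro hcop
    exact rank_hankel1_half_dualSeq_of_isCoprime K hm hcop h2d

end Summit.Ventures.HSemireg.Wedge.HankelOuter
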